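import Mathlib
import HarnessLib
import Summits.RiemannHypothesis.RiemannHypothesis.Theorems.IntegerScrewCSharpUpperPrep


/-!
# Route `IntegerScrew` — THEOREM C♯, UPPER HALF, UNCONDITIONALLY IN THE KERNEL:
# `p⁰₁₁(τ/log M) ≤ e^{65τ/log M}·g(τ)` for every `M ≥ 2`, `τ > 0`

The upper half of THEOREM C♯ (PIVOT-LAW 13.44 / CONTINUUM-LIMIT §16) transfers the weighted comparison function
`h′ = h̃·W`, `W(x) = Π_{p∣x} p/(p−1)`; CONTINUUM-LIMIT 16.5 (b)–(g) bound `(𝒜_D − ∂_u)h′ ≤ ε⁺_L h′` with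
`ε⁺_L = 7.5/L + O(ℓ²/L²)`.  This file proves the cruder but UNCONDITIONAL `ε⁺_L = 65/L` in the kernel, from
the exact decomposition for `h′` (`IntegerScrewBirthIdentity.generator_sub_deriv_eq_hPrime`):

* every `a = 1` term is `(log q/(qL))F(θ_q) + R_q` with `R_q = (log q/(qL))K(u,ρ−θ_q)(χ′_q − φ(θ_q))`:
  `R_q ≤ 2K·log q/(q(q−1)L)` for a new prime and `R_q = (log q/(qL))K(u,ρ−θ_q)e^{−uθ_q}` for a present one;
* every `a ≥ 2` term is `≤ 4K·log q/(q^aL)` (`K(u,ρ−aθ_q) ≤ K(u,0) ≤ 2K`, `χ′ ≤ 2`); the tail `Σ_qΣ_{a≥2} ≤ 8` and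
  `Σ_q log q/(q(q−1)) ≤ 8` (`IntegerScrewCSharpLower`'s telescoping);
* the `F`-sum against `I` is `E_Mert ≤ 16K/L` (`IntegerScrewEMertBound`, the tree's Mertens facts);
* THE PAIRING (16.5 (f)): for a present prime `p`, `Π·R_p − (θ_p/p)·h̃(x/p^{v_p}) ≤ Π(θ_p/p)(K − K(u,ρ+v_pθ_p))
  ≤ Π(θ_p/p)·u v_pθ_p|c|` (using `K(u,ρ−θ)e^{−uθ} ≤ K(u,ρ)` and `h̃(x/p^{v})φ(θ_p) = K(u,ρ+vθ_p)Π`), and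
  `Σ_{p∣x} v_p(log p)²/p ≤ ½·log x ≤ L/2` (`log p/p ≤ ½`), `u|c| ≤ 2K` — this is what removes the `log L` that
  `Σ_{p∣x} log p/p` would cost and why the weight `W` is there.

RESULTS: `sixteen_five_upper` — for `2 ≤ M`, `u > 0`, `1 ≤ x ≤ M`: `births + deaths − ∂_uh′ ≤ (65/log M)·h′(u;x)`;
**`returnProb_le_csharp` — for `2 ≤ M`, `τ > 0`: `(e^{τ·walkGen M})₁₁ ≤ e^{(65/log M)τ}·g(τ)`**; with
`IntegerScrewCSharpLower.returnProb_ge_csharp`: **`|log(p⁰₁₁(τ/log M)/g(τ))| ≤ 65τ/log M` — THEOREM C♯ with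
explicit crude constants, unconditionally.**  RH-free; nothing here bears on the truth of RH.
References: CONTINUUM-LIMIT §16.4–16.5; PIVOT-LAW 13.44, 13.49–13.53; M. Suzuki, J. Lond. Math. Soc. (2) 108 (2023)
1448–1487 [Suzuki2023].
(The elementary estimates are in `IntegerScrewCSharpUpperPrep`; this file keeps the assembly `sixteen_five_upper` and the two return-probability theorems.)
-/

noncomputable section

-- D-0017: `Summit.<S>.<S>.…` is the designed namespace of a single-problem summit.
set_option linter.dupNamespace false

namespace Summit.RiemannHypothesis.RiemannHypothesis.Theorems.IntegerScrew

open Real Finset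

/-- **16.5, upper half, in the kernel.** For `2 ≤ M`, `u > 0`, `1 ≤ x ≤ M`, with `L = log M`:
`births + deaths − ∂_u h′ ≤ (65/L)·h′(u;x)`. -/
theorem sixteen_five_upper {M : ℕ} (hM : 2 ≤ M) {u : ℝ} (hu : 0 < u) {x : ℕ} (hx : x ∈ Finset.Icc 1 M) :
    (∑ n ∈ Finset.Icc 1 (M / x), (ArithmeticFunction.vonMangoldt n : ℝ) / ((n : ℝ) * Real.log M) *
          (hPrime (Real.log M) u (x * n) - hPrime (Real.log M) u x)) +
        (∑ d ∈ x.divisors, (ArithmeticFunction.vonMangoldt d : ℝ) / Real.log M *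
          (hPrime (Real.log M) u (x / d) - hPrime (Real.log M) u x)) -
        hPrimeDeriv (Real.log M) u x ≤ 65 / Real.log M * hPrime (Real.log M) u x := by
  obtain ⟨hx1, hxM⟩ := Finset.mem_Icc.mp hx
  set L := Real.log M with hLdef
  have hL : 0 < L := Real.log_pos (by exact_mod_cast (by omega : 1 < M))
  have hx0 : x ≠ 0 := by omega
  set ρ := room L x with hρdef
  have hρ0 : 0 ≤ ρ := by
    have := room_sub_nonneg (q := 2) (a := 0) hM hx1 hxM Nat.prime_two (Nat.zero_le _)
    simpa [hρdef] using this
  have hρ1 : ρ ≤ 1 := by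
    rw [hρdef]; unfold room
    have : 0 ≤ Real.log x / L := div_nonneg (Real.log_nonneg (by exact_mod_cast hx1)) hL.le
    linarith
  rw [generator_sub_deriv_eq_hPrime L hu.ne' hx0]
  set P := (Finset.Icc 1 (M / x)).filter Nat.Prime with hPdef
  set Pi := primeProd L u x with hPidef
  set K := ccpK u ρ with hKdef
  have hPi : 0 ≤ Pi := primeProd_nonneg hL.le hu.le x
  have hW : 0 ≤ wProd x := le_trans zero_le_one (one_le_wProd x)
  have hK : 0 ≤ K := (ccpK_pos hu ρ).le
  -- (1) the (q,a)-sum bounded prime by prime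
  have hS : (∑ q ∈ P, ∑ a ∈ Finset.Icc 1 (Nat.log q (M / x)), Real.log q / ((q : ℝ) ^ a * L) *
        (ccpK u (ρ - a * (Real.log q / L)) * birthChiW L u x q - ccpK u ρ)) ≤
      ∑ q ∈ P, (Real.log q / ((q : ℝ) * L) *
          (ccpK u (ρ - Real.log q / L) * (1 - Real.exp (-(u * (Real.log q / L)))) - ccpK u ρ)
        + 2 * K * (Real.log q / ((q : ℝ) * ((q : ℝ) - 1) * L))
        + (if q ∣ x then Real.log q / ((q : ℝ) * L) *
            (ccpK u (ρ - Real.log q / L) * Real.exp (-(u * (Real.log q / L)))) else 0)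
        + 4 * K / L * ∑ a ∈ Finset.Icc 2 (Nat.log q (M / x)), Real.log q / (q : ℝ) ^ a) := by
    refine Finset.sum_le_sum fun q hq => ?_
    have hqP : q.Prime := (Finset.mem_filter.mp hq).2
    have hqle : q ≤ M / x := (Finset.mem_Icc.mp (Finset.mem_filter.mp hq).1).2
    exact inner_sum_le hM hx1 hxM hqP hqle hu
  rw [Finset.sum_add_distrib, Finset.sum_add_distrib, Finset.sum_add_distrib] at hS
  -- (2) the four pieces of the bound
  have hF : ∑ q ∈ P, Real.log q / ((q : ℝ) * L) *
        (ccpK u (ρ - Real.log q / L) * (1 - Real.exp (-(u * (Real.log q / L)))) - ccpK u ρ) =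
      (1 / L) * ∑ q ∈ Nat.primesLE (M / x), Real.log q / q *
        (ccpK u (ρ - Real.log q / L) * (1 - Real.exp (-(u * (Real.log q / L)))) - ccpK u ρ) := by
    rw [hPdef, filter_prime_Icc_one, Finset.mul_sum]
    refine Finset.sum_congr rfl fun q _ => ?_
    field_simp
  have hw1 : ∑ q ∈ P, 2 * K * (Real.log q / ((q : ℝ) * ((q : ℝ) - 1) * L)) ≤ 16 * K / L := by
    have h8 := sum_primes_log_div_mul_pred_le_eight (M / x)
    have e : ∑ q ∈ P, 2 * K * (Real.log q / ((q : ℝ) * ((q : ℝ) - 1) * L)) =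
        (2 * K / L) * ∑ q ∈ P, Real.log q / ((q : ℝ) * ((q : ℝ) - 1)) := by
      rw [Finset.mul_sum]; refine Finset.sum_congr rfl fun q _ => ?_; field_simp
    rw [e]
    have : 0 ≤ 2 * K / L := by positivity
    calc 2 * K / L * _ ≤ 2 * K / L * 8 := mul_le_mul_of_nonneg_left h8 this
      _ = 16 * K / L := by ring
  have htail : ∑ q ∈ P, 4 * K / L * ∑ a ∈ Finset.Icc 2 (Nat.log q (M / x)), Real.log q / (q : ℝ) ^ a ≤
      32 * K / L := by
    rw [← Finset.mul_sum]
    have h8 := primePower_tail_le_eight (M / x) (fun q => Nat.log q (M / x))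
    have : 0 ≤ 4 * K / L := by positivity
    calc 4 * K / L * _ ≤ 4 * K / L * 8 := mul_le_mul_of_nonneg_left h8 this
      _ = 32 * K / L := by ring
  have hite := sum_ite_dvd_eq_sum_primeFactors_ite (M := M) hx0
    (fun q => Real.log q / ((q : ℝ) * L) * (ccpK u (ρ - Real.log q / L) * Real.exp (-(u * (Real.log q / L)))))
  -- (3) E_Mert (upper) unconditionally
  have hE := (prime_sum_bracketF_sub_integral_bounds hM hx1 hxM hu).2
  -- (4) the pairing, summed over the present primes
  have hpair : Pi * ∑ p ∈ x.primeFactors, (if p ≤ M / x then Real.log p / ((p : ℝ) * L) *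
          (ccpK u (ρ - Real.log p / L) * Real.exp (-(u * (Real.log p / L)))) else 0)
        - ∑ p ∈ x.primeFactors, Real.log p / L / p * hTilde L u (x / p ^ x.factorization p) ≤ Pi * K / L := by
    rw [Finset.mul_sum, ← Finset.sum_sub_distrib]
    have hstep : ∀ p ∈ x.primeFactors,
        Pi * (if p ≤ M / x then Real.log p / ((p : ℝ) * L) *
            (ccpK u (ρ - Real.log p / L) * Real.exp (-(u * (Real.log p / L)))) else 0)
          - Real.log p / L / p * hTilde L u (x / p ^ x.factorization p) ≤
        Pi * (Real.log p / ((p : ℝ) * L) * (u * (x.factorization p * (Real.log p / L)) * |ccpc u|)) := by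
      intro p hp
      have hpp := Nat.prime_of_mem_primeFactors hp
      have hpx := Nat.dvd_of_mem_primeFactors hp
      exact pairing_le hL hu hx0 hpp hpx hρ0 (p ≤ M / x)
    calc _ ≤ ∑ p ∈ x.primeFactors, Pi * (Real.log p / ((p : ℝ) * L) *
            (u * (x.factorization p * (Real.log p / L)) * |ccpc u|)) := Finset.sum_le_sum hstep
      _ = Pi * (u * |ccpc u|) * ∑ p ∈ x.primeFactors,
            Real.log p / ((p : ℝ) * L) * (x.factorization p * (Real.log p / L)) := by
          rw [Finset.mul_sum]; refine Finset.sum_congr rfl fun p _ => ?_; ring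
      _ ≤ Pi * (u * |ccpc u|) * ((1 - ρ) / (2 * L)) :=
          mul_le_mul_of_nonneg_left (sum_primeFactors_weight_le hL x)
            (mul_nonneg hPi (mul_nonneg hu.le (abs_nonneg _)))
      _ ≤ Pi * (2 * K) * (1 / (2 * L)) := by
          have huc : u * |ccpc u| ≤ 2 * K := mul_abs_ccpc_le_two_mul_ccpK hu hρ1
          have h1 : (1 - ρ) / (2 * L) ≤ 1 / (2 * L) := by
            apply div_le_div_of_nonneg_right _ (by positivity); linarith
          have h2 : 0 ≤ (1 - ρ) / (2 * L) := by apply div_nonneg _ (by positivity); linarith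
          calc Pi * (u * |ccpc u|) * ((1 - ρ) / (2 * L)) ≤ Pi * (2 * K) * ((1 - ρ) / (2 * L)) := by
                gcongr
            _ ≤ Pi * (2 * K) * (1 / (2 * L)) := by gcongr
      _ = Pi * K / L := by field_simp
  -- (5) assemble the core inequality  Π·S − Π·I − deaths ≤ 65ΠK/L
  have hcore : Pi * (∑ q ∈ P, ∑ a ∈ Finset.Icc 1 (Nat.log q (M / x)), Real.log q / ((q : ℝ) ^ a * L) *
        (ccpK u (ρ - a * (Real.log q / L)) * birthChiW L u x q - ccpK u ρ))
      - (ccpI u ρ * Pi + ∑ p ∈ x.primeFactors, Real.log p / L / p * hTilde L u (x / p ^ x.factorization p))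
      ≤ 65 * K * Pi / L := by
    have hSPi := mul_le_mul_of_nonneg_left hS hPi
    rw [hF, hite] at hSPi
    -- E_Mert piece: Π·[(1/L)ΣF − I] ≤ 16KΠ/L
    have hEM : Pi * ((1 / L) * ∑ q ∈ Nat.primesLE (M / x), Real.log q / q *
        (ccpK u (ρ - Real.log q / L) * (1 - Real.exp (-(u * (Real.log q / L)))) - ccpK u ρ)) - ccpI u ρ * Pi
        ≤ 16 * K * Pi / L := by
      have key : ∀ S I : ℝ, Pi * ((1 / L) * S) - I * Pi = (Pi / L) * (S - L * I) := by
        intro S I; field_simp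
      rw [key]
      have := mul_le_mul_of_nonneg_left hE (div_nonneg hPi hL.le)
      calc Pi / L * _ ≤ Pi / L * (16 * ccpK u (room (Real.log M) x)) := this
        _ = 16 * K * Pi / L := by rw [hKdef, hρdef, hLdef]; ring
    have hw1' := mul_le_mul_of_nonneg_left hw1 hPi
    have htail' := mul_le_mul_of_nonneg_left htail hPi
    have e65 : 65 * K * Pi / L = 16 * K * Pi / L + Pi * (16 * K / L) + Pi * K / L + Pi * (32 * K / L) := by ring
    rw [e65]
    nlinarith [hSPi, hEM, hw1', htail', hpair]
  -- (6) multiply by W ≥ 0 and recognise h′ = K·Π·W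
  have hT := mul_le_mul_of_nonneg_left hcore hW
  have e1 : primeProd L u x * wProd x *
        (∑ q ∈ P, ∑ a ∈ Finset.Icc 1 (Nat.log q (M / x)), Real.log q / ((q : ℝ) ^ a * L) *
          (ccpK u (ρ - a * (Real.log q / L)) * birthChiW L u x q - ccpK u ρ)) -
      wProd x * (ccpI u ρ * primeProd L u x +
        ∑ p ∈ x.primeFactors, Real.log p / L / p * hTilde L u (x / p ^ x.factorization p)) =
      wProd x * (Pi * (∑ q ∈ P, ∑ a ∈ Finset.Icc 1 (Nat.log q (M / x)), Real.log q / ((q : ℝ) ^ a * L) *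
          (ccpK u (ρ - a * (Real.log q / L)) * birthChiW L u x q - ccpK u ρ))
        - (ccpI u ρ * Pi + ∑ p ∈ x.primeFactors, Real.log p / L / p * hTilde L u (x / p ^ x.factorization p))) := by
    rw [hPidef]; ring
  have e2 : 65 / L * hPrime L u x = wProd x * (65 * K * Pi / L) := by
    unfold hPrime hTilde; rw [hKdef, hρdef, hPidef]; ring
  rw [e1, e2]
  exact hT

/-- **THEOREM C♯, UPPER HALF (kernel, unconditional).** For every `M ≥ 2` and `τ > 0`:
`(e^{τ·𝒜_M})₁₁ ≤ e^{(65/log M)·τ}·g(τ)`. -/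
theorem returnProb_le_csharp {M : ℕ} (hM : 2 ≤ M) {τ : ℝ} (hτ : 0 < τ) :
    (NormedSpace.exp (τ • walkGen M)) (stOne (by omega : 1 ≤ M)) (stOne (by omega : 1 ≤ M)) ≤
      Real.exp (65 / Real.log M * τ) * ccpg τ :=
  returnProb_le_of_sixteen_four (by omega) hτ fun u hu x hx => sixteen_five_upper hM hu hx

/-- **THEOREM C♯ (kernel, unconditional, crude constants)**: for `M ≥ 2`, `τ > 0`,
`e^{−16τ/log M}·g(τ) ≤ P_1(X_{τ/log M} = 1) ≤ e^{65τ/log M}·g(τ)`. -/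
theorem returnProb_csharp {M : ℕ} (hM : 2 ≤ M) {τ : ℝ} (hτ : 0 < τ) :
    Real.exp (-(16 / Real.log M * τ)) * ccpg τ ≤
        (NormedSpace.exp (τ • walkGen M)) (stOne (by omega : 1 ≤ M)) (stOne (by omega : 1 ≤ M)) ∧
      (NormedSpace.exp (τ • walkGen M)) (stOne (by omega : 1 ≤ M)) (stOne (by omega : 1 ≤ M)) ≤
        Real.exp (65 / Real.log M * τ) * ccpg τ :=
  ⟨returnProb_ge_csharp hM hτ, returnProb_le_csharp hM hτ⟩

end Summit.RiemannHypothesis.RiemannHypothesis.Theorems.IntegerScrew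

end
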